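import Summits.CriticalPhenomena.CardyFormulaZ2.Theorems.CardyComplexConeEdgePrecompactUFRSHalfPlaneArms

/-!
# The touchdown trichotomy of a strand with fake edges (abstract combinatorial core)
(line `qkz-strip-boundary-arm` of crux `CardyComplexCone.EdgePrecompact`, stmt-CriticalPhenomena-11387;
combinatorial heart of the CORRECTED dichotomy behind the flat three-strand decay HT for mixed
tags — worker W-HT5 of lead c5, wave 5; the registered `ufrs_rect_threeStrands_dichotomy` of
wave 4 is false, see the lead's folder, EVIDENCE-ufrs_rect_threeStrands_dichotomy.md)

**Setting.** The strand selected by the sector argument at `z` is cut at its chain-fakes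
(followed edges of the completed configuration that are closed in `ω`) into fake-free pieces
`P₀, …, P_{M+1}`; piece `P_l` (`l ≤ M`) ends at the touchdown point `p_l` at radial distance
`d l` from the centre and piece `P_{l+1}` starts at a lattice neighbour of `p_l`. Only real
numbers enter: `μ l` / `ν l` = min / max radial distance of the vertices of `P_l`; `ρm l`
(`ρp l`) = the spatial reach of `P_l` (`P_{l+1}`) seen from `p_l`, so that
`d l - μ l ≤ ρm l`, `ν l - d l ≤ ρm l`, `d l - μ (l+1) ≤ ρp l`, `ν (l+1) - d l ≤ ρp l`;
`μ l ≤ d l + 1`, `d l - 1 ≤ ν l`, `μ (l+1) ≤ d l + 1`, `d l - 1 ≤ ν (l+1)` (the touchdown is within `1`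
of both adjacent pieces — symmetric under reversing the orientation); the near piece has `μ 0 ≤ r₀`, the far
piece has `Rfar ≤ ν (M+1)`.

**Theorem** (`crawl_trichotomy_HT5`; registered anchor `ufrs_crawlTrichotomy`). With a window
`mw`, a sticky threshold `Θ`, a range `RB` and a reach fraction `0 < ε ≤ 1/100` subject to
`2 r₀ + 2 ≤ Θ`, `2Θ + 8 ≤ mw`, `102 ≤ mw ≤ RB`, `(1+ε) RB ≤ Rfar`, one of:
(GOOD) a piece meets the window and reaches `RB/4`; (BAD) some touchdown `p_l` with
`Θ ≤ d l ≤ 4Ν` has an adjacent piece of reach `≥ ε d l`, where `Ν < RB/4` is the maximal reach of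
a window piece (the "`Ν`-piece" `l'` is returned); (CRAWL) a run `b ≤ l ≤ e ≤ M` of STICKY
touchdowns (`Θ ≤ d l ≤ 4Ν`, both reaches `< ε d l`) whose radial distances cross a band
`[A, 6A/5]` monotonically (`d b ≤ A`, `6A/5 ≤ d e` or the reverse, strictly inside in between),
with `Ν ≤ A`, `(6A/5)(1+4ε) + 2 ≤ 4Ν`, the padded band avoiding one prescribed radius `D`.
Proof: extremal combinatorics on finite sequences — the far piece is not a window piece, the
maximal window reach is `≥ mw - 2`, the last index below a threshold `τ ∈ [Ν, 4Ν]` is sticky and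
close to `τ`, maximal backward sticky runs start just above `Θ` or just below `4Ν`, and a discrete
intermediate-value step extracts the band crossing (two stages `τ = 4Ν`, `τ = 2Ν`).

References: M. Aizenman, A. Burchard, Duke Math. J. 99 (1999), App. A (bookkeeping of crossing
strands); G. F. Lawler, O. Schramm, W. Werner, Electron. J. Probab. 7 (2002), App. A.
(buildfix 2026-08-20: comment-only re-land to re-enqueue the module build after its blocking imports were repaired; no declaration changed.)
-/

namespace Summit.CriticalPhenomena.CardyFormulaZ2.Cruxes.EdgePrecompact.QkzStripBoundaryArm

open MeasureTheory Filter Set Metric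
open scoped Topology BigOperators Pointwise
open Literature.Probability.LatticeModels Literature.Probability.Percolation
open Literature.Probability.RandomPlanarGeometry (DobrushinDomain)
open Summit.CriticalPhenomena.CardyFormulaZ2.Theses.CardyComplexCone

noncomputable section

/-! ## Discrete intermediate values and band selection -/

/-- **Discrete intermediate values, increasing.** In a run `s ≤ l ≤ L` whose first value is
`≤ A` and whose last value is `≥ B > A`, some stretch `b < l < e` lies strictly inside `(A, B)`
with `d b ≤ A` and `B ≤ d e`. -/
theorem ivt_up_HT5 (d : ℕ → ℝ) {s L : ℕ} (hsL : s ≤ L) {A B : ℝ} (hAB : A < B) (hs : d s ≤ A) (hL : B ≤ d L) :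
    ∃ b e : ℕ, s ≤ b ∧ b < e ∧ e ≤ L ∧ d b ≤ A ∧ B ≤ d e ∧ ∀ l, b < l → l < e → A < d l ∧ d l < B := by
  classical
  have hex : ∃ e, s ≤ e ∧ e ≤ L ∧ B ≤ d e := ⟨L, hsL, le_rfl, hL⟩
  obtain ⟨e, ⟨hse, heL, hBe⟩, hemin⟩ : ∃ e, (s ≤ e ∧ e ≤ L ∧ B ≤ d e) ∧ ∀ l < e, ¬ (s ≤ l ∧ l ≤ L ∧ B ≤ d l) :=
    ⟨Nat.find hex, Nat.find_spec hex, fun l hl => Nat.find_min hex hl⟩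
  have hmin : ∀ l, s ≤ l → l < e → d l < B := by
    intro l hsl hle
    by_contra hc; push Not at hc
    exact hemin l hle ⟨hsl, by omega, hc⟩
  have hse' : s < e := lt_of_le_of_ne hse (by rintro rfl; linarith)
  set T : Finset ℕ := (Finset.Ico s e).filter (fun l => d l ≤ A) with hT
  have hsT : s ∈ T := by rw [hT, Finset.mem_filter, Finset.mem_Ico]; exact ⟨⟨le_rfl, hse'⟩, hs⟩
  have hTne : T.Nonempty := ⟨s, hsT⟩
  set b := T.max' hTne with hb
  have hbT : b ∈ T := Finset.max'_mem T hTne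
  rw [hT, Finset.mem_filter, Finset.mem_Ico] at hbT
  refine ⟨b, e, hbT.1.1, hbT.1.2, heL, hbT.2, hBe, fun l hbl hle => ⟨?_, hmin l (by omega) hle⟩⟩
  by_contra hc; push Not at hc
  have hlT : l ∈ T := by rw [hT, Finset.mem_filter, Finset.mem_Ico]; exact ⟨⟨by omega, hle⟩, hc⟩
  have := T.le_max' l hlT
  rw [← hb] at this
  omega

/-- **Discrete intermediate values, decreasing.** -/
theorem ivt_down_HT5 (d : ℕ → ℝ) {s L : ℕ} (hsL : s ≤ L) {A B : ℝ} (hAB : A < B) (hs : B ≤ d s) (hL : d L ≤ A) :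
    ∃ b e : ℕ, s ≤ b ∧ b < e ∧ e ≤ L ∧ B ≤ d b ∧ d e ≤ A ∧ ∀ l, b < l → l < e → A < d l ∧ d l < B := by
  classical
  have hex : ∃ e, s ≤ e ∧ e ≤ L ∧ d e ≤ A := ⟨L, hsL, le_rfl, hL⟩
  obtain ⟨e, ⟨hse, heL, hAe⟩, hemin⟩ : ∃ e, (s ≤ e ∧ e ≤ L ∧ d e ≤ A) ∧ ∀ l < e, ¬ (s ≤ l ∧ l ≤ L ∧ d l ≤ A) :=
    ⟨Nat.find hex, Nat.find_spec hex, fun l hl => Nat.find_min hex hl⟩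
  have hmin : ∀ l, s ≤ l → l < e → A < d l := by
    intro l hsl hle
    by_contra hc; push Not at hc
    exact hemin l hle ⟨hsl, by omega, hc⟩
  have hse' : s < e := lt_of_le_of_ne hse (by rintro rfl; linarith)
  set T : Finset ℕ := (Finset.Ico s e).filter (fun l => B ≤ d l) with hT
  have hsT : s ∈ T := by rw [hT, Finset.mem_filter, Finset.mem_Ico]; exact ⟨⟨le_rfl, hse'⟩, hs⟩
  have hTne : T.Nonempty := ⟨s, hsT⟩
  set b := T.max' hTne with hb
  have hbT : b ∈ T := Finset.max'_mem T hTne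
  rw [hT, Finset.mem_filter, Finset.mem_Ico] at hbT
  refine ⟨b, e, hbT.1.1, hbT.1.2, heL, hbT.2, hAe, fun l hbl hle => ⟨hmin l (by omega) hle, ?_⟩⟩
  by_contra hc; push Not at hc
  have hlT : l ∈ T := by rw [hT, Finset.mem_filter, Finset.mem_Ico]; exact ⟨⟨by omega, hle⟩, hc⟩
  have := T.le_max' l hlT
  rw [← hb] at this
  omega

/-- **Band selection avoiding one radius.** Of the two candidate bases `A₁` and `7A₁/5`
(`A₁ ≥ 42`), one has its padded band `[A(1-4ε)-2, (6A/5)(1+4ε)+2]` not containing `D`. -/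
theorem band_avoid_HT5 {ε : ℝ} (hε : 0 < ε) (hε' : ε ≤ 1 / 100) (D A₁ : ℝ) (hA : 42 ≤ A₁) :
    ∃ A, (A = A₁ ∨ A = 7 / 5 * A₁) ∧ (6 / 5 * A * (1 + 4 * ε) + 2 ≤ D ∨ D ≤ A * (1 - 4 * ε) - 2) := by
  by_cases h1 : 6 / 5 * A₁ * (1 + 4 * ε) + 2 ≤ D ∨ D ≤ A₁ * (1 - 4 * ε) - 2
  · exact ⟨A₁, Or.inl rfl, h1⟩
  · push Not at h1
    refine ⟨7 / 5 * A₁, Or.inr rfl, Or.inr ?_⟩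
    nlinarith [h1.1, h1.2]

/-! ## The trichotomy -/

set_option maxHeartbeats 400000 in
/-- **The touchdown trichotomy** (see the module docstring). -/
theorem crawl_trichotomy_HT5 (M : ℕ) (μ ν d ρm ρp : ℕ → ℝ) (r₀ Rfar mw Θ RB ε D : ℝ)
    (hε : 0 < ε) (hε' : ε ≤ 1 / 100) (hr₀ : 0 ≤ r₀) (hΘ : 2 * r₀ + 2 ≤ Θ) (hmw : 2 * Θ + 8 ≤ mw)
    (hmw' : 102 ≤ mw) (hRB : mw ≤ RB) (hfar : (1 + ε) * RB ≤ Rfar)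
    (H1 : ∀ l ≤ M, μ l ≤ d l + 1 ∧ d l - 1 ≤ ν l)
    (H2 : ∀ l ≤ M, μ (l + 1) ≤ d l + 1 ∧ d l - 1 ≤ ν (l + 1))
    (H3 : ∀ l ≤ M, d l - μ l ≤ ρm l ∧ ν l - d l ≤ ρm l ∧ d l - μ (l + 1) ≤ ρp l ∧ ν (l + 1) - d l ≤ ρp l)
    (H4 : μ 0 ≤ r₀) (H5 : Rfar ≤ ν (M + 1)) :
    (∃ l ≤ M + 1, μ l ≤ mw ∧ RB / 4 ≤ ν l) ∨
    (∃ l ≤ M, ∃ l' ≤ M + 1, μ l' ≤ mw ∧ ν l' < RB / 4 ∧ Θ ≤ d l ∧ d l ≤ 4 * ν l' ∧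
      (ε * d l ≤ ρm l ∨ ε * d l ≤ ρp l)) ∨
    (∃ l' ≤ M + 1, μ l' ≤ mw ∧ ν l' < RB / 4 ∧ mw - 2 ≤ ν l' ∧
      ∃ A : ℝ, ν l' ≤ A ∧ 6 / 5 * A * (1 + 4 * ε) + 2 ≤ 4 * ν l' ∧
        (6 / 5 * A * (1 + 4 * ε) + 2 ≤ D ∨ D ≤ A * (1 - 4 * ε) - 2) ∧
        ∃ b e : ℕ, b < e ∧ e ≤ M ∧
          (∀ l, b ≤ l → l ≤ e → Θ ≤ d l ∧ d l ≤ 4 * ν l' ∧ ρm l < ε * d l ∧ ρp l < ε * d l) ∧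
          (∀ l, b < l → l < e → A < d l ∧ d l < 6 / 5 * A) ∧
          ((d b ≤ A ∧ 6 / 5 * A ≤ d e) ∨ (6 / 5 * A ≤ d b ∧ d e ≤ A))) := by
  classical
  -- the window set and its maximal reach
  set WS : Finset ℕ := (Finset.range (M + 2)).filter (fun l => μ l ≤ mw) with hWS
  have hmemW : ∀ {l}, l ∈ WS ↔ l ≤ M + 1 ∧ μ l ≤ mw := by
    intro l; rw [hWS, Finset.mem_filter, Finset.mem_range]; constructor
    · rintro ⟨h1, h2⟩; exact ⟨by omega, h2⟩
    · rintro ⟨h1, h2⟩; exact ⟨by omega, h2⟩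
  have h0W : 0 ∈ WS := hmemW.2 ⟨by omega, H4.trans (by linarith)⟩
  obtain ⟨l', hl'W, hl'max⟩ := Finset.exists_max_image WS ν ⟨0, h0W⟩
  obtain ⟨hl'M1, hl'μ⟩ := hmemW.1 hl'W
  -- GOOD?
  by_cases hgood : RB / 4 ≤ ν l'
  · exact Or.inl ⟨l', hl'M1, hl'μ, hgood⟩
  push Not at hgood
  right
  -- F0: the far piece is not a window piece
  have hfarW : mw < μ (M + 1) := by
    by_contra hc; push Not at hc
    have := hl'max (M + 1) (hmemW.2 ⟨le_rfl, hc⟩)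
    nlinarith
  have hl'M : l' ≤ M := by
    by_contra hc
    have : l' = M + 1 := by omega
    rw [this] at hl'μ; linarith
  have hdM : mw - 1 < d M := by have := (H2 M le_rfl).1; linarith
  -- F1: Ν ≥ mw - 2
  have hΝmw : mw - 2 ≤ ν l' := by
    by_contra hc; push Not at hc
    have hall : ∀ l, l ≤ M + 1 → l ∈ WS := by
      intro l
      induction l with
      | zero => intro; exact h0W
      | succ n ih =>
        intro hn
        have hνn : ν n ≤ ν l' := hl'max n (ih (by omega))
        have hdn : d n - 1 ≤ ν n := (H1 n (by omega)).2
        have hμ : μ (n + 1) ≤ d n + 1 := (H2 n (by omega)).1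
        exact hmemW.2 ⟨hn, by linarith⟩
    have := (hmemW.1 (hall (M + 1) le_rfl)).2
    linarith
  set Ν := ν l' with hΝ
  have hΝ100 : 100 ≤ Ν := by linarith
  have hΘ2 : 2 ≤ Θ := by linarith
  -- validity
  by_cases hval : ∃ l ≤ M, Θ ≤ d l ∧ d l ≤ 4 * Ν ∧ (ε * d l ≤ ρm l ∨ ε * d l ≤ ρp l)
  · obtain ⟨l, hlM, h1, h2, h3⟩ := hval
    exact Or.inl ⟨l, hlM, l', hl'M1, hl'μ, hgood, h1, h2, h3⟩
  push Not at hval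
  right
  -- stickiness
  set St : ℕ → Prop := fun l => Θ ≤ d l ∧ d l ≤ 4 * Ν ∧ ρm l < ε * d l ∧ ρp l < ε * d l with hSt
  have hsticky_of : ∀ l ≤ M, Θ ≤ d l → d l ≤ 4 * Ν → St l := fun l hlM h1 h2 =>
    ⟨h1, h2, (hval l hlM h1 h2).1, (hval l hlM h1 h2).2⟩
  -- a sticky step: the previous touchdown is radially close
  have hstep : ∀ l, 1 ≤ l → l ≤ M → St l → d l * (1 - ε) - 1 < d (l - 1) ∧ d (l - 1) < d l * (1 + ε) + 1 := by
    intro l hl1 hlM hst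
    obtain ⟨h2a, h2b⟩ := H2 (l - 1) (by omega)
    rw [show l - 1 + 1 = l by omega] at h2a h2b
    obtain ⟨h3a, h3b, -, -⟩ := H3 l hlM
    have := hst.2.2.1
    constructor <;> linarith
  -- index 0 is never sticky
  have h0 : ¬ St 0 := by
    intro hst
    obtain ⟨h3a, -, -, -⟩ := H3 0 (by omega)
    have h1 := hst.1; have h2 := hst.2.2.1
    nlinarith
  -- F2: d M > 4Ν
  have hdM4 : 4 * Ν < d M := by
    by_contra hc; push Not at hc
    have h3 := (H3 M le_rfl).2.2.2
    have hΘM : Θ ≤ d M := by linarith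
    have := (hval M le_rfl hΘM hc).2
    nlinarith
  -- F3: the last index below a threshold τ ∈ [Ν, 4Ν] is sticky and close to τ
  have hF3 : ∀ τ, Ν + 1 ≤ τ → τ ≤ 4 * Ν → ∃ l₁, l₁ < M ∧ d l₁ ≤ τ ∧ τ - 1 < d l₁ * (1 + ε) ∧ St l₁ := by
    intro τ hτ1 hτ2
    set T : Finset ℕ := (Finset.range (M + 1)).filter (fun l => d l ≤ τ) with hT
    have hl'T : l' ∈ T := by
      rw [hT, Finset.mem_filter, Finset.mem_range]
      exact ⟨by omega, by have := (H1 l' hl'M).2; linarith⟩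
    have hTne : T.Nonempty := ⟨l', hl'T⟩
    set l₁ := T.max' hTne with hl₁
    have hl₁T : l₁ ∈ T := Finset.max'_mem T hTne
    rw [hT, Finset.mem_filter, Finset.mem_range] at hl₁T
    obtain ⟨hl₁M, hdl₁⟩ := hl₁T
    have hl₁M' : l₁ < M := by
      by_contra h1
      have : l₁ = M := by omega
      rw [this] at hdl₁; linarith
    have hnext : τ < d (l₁ + 1) := by
      by_contra hc; push Not at hc
      have hmem : l₁ + 1 ∈ T := by
        rw [hT, Finset.mem_filter, Finset.mem_range]; exact ⟨by omega, hc⟩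
      have := T.le_max' (l₁ + 1) hmem
      rw [← hl₁] at this
      omega
    have hΘl₁ : Θ ≤ d l₁ := by
      by_contra hc; push Not at hc
      have hW1 : l₁ + 1 ∈ WS := by
        refine hmemW.2 ⟨by omega, ?_⟩
        have := (H2 l₁ (by omega)).1; linarith
      have h1 := hl'max _ hW1
      have h2 := (H1 (l₁ + 1) (by omega)).2
      linarith
    have hst : St l₁ := hsticky_of l₁ (by omega) hΘl₁ (hdl₁.trans hτ2)
    refine ⟨l₁, hl₁M', hdl₁, ?_, hst⟩
    have h3 := (H3 l₁ (by omega)).2.2.2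
    have h4 := (H1 (l₁ + 1) (by omega)).2
    have h5 := hst.2.2.2
    nlinarith
  -- maximal backward sticky runs
  have hrun : ∀ L₀, L₀ ≤ M → St L₀ → ∃ s, 1 ≤ s ∧ s ≤ L₀ ∧ (∀ l, s ≤ l → l ≤ L₀ → St l) ∧
      (d (s - 1) < Θ ∨ 4 * Ν < d (s - 1)) := by
    intro L₀ hL₀M hL₀
    have hex : ∃ s, s ≤ L₀ ∧ ∀ l, s ≤ l → l ≤ L₀ → St l :=
      ⟨L₀, le_rfl, fun l h1 h2 => by rw [show l = L₀ from le_antisymm h2 h1]; exact hL₀⟩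
    obtain ⟨s, ⟨hsL, hspec⟩, hsmin⟩ : ∃ s, (s ≤ L₀ ∧ ∀ l, s ≤ l → l ≤ L₀ → St l) ∧
        ∀ s' < s, ¬ (s' ≤ L₀ ∧ ∀ l, s' ≤ l → l ≤ L₀ → St l) :=
      ⟨Nat.find hex, Nat.find_spec hex, fun s' hs' => Nat.find_min hex hs'⟩
    have hs1 : 1 ≤ s := by
      by_contra hc
      exact h0 (hspec 0 (by omega) (by omega))
    have hnst : ¬ St (s - 1) := by
      intro hc
      refine hsmin (s - 1) (by omega) ⟨by omega, fun l h1 h2 => ?_⟩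
      rcases Nat.lt_or_ge l s with h3 | h3
      · rw [show l = s - 1 by omega]; exact hc
      · exact hspec l h3 h2
    refine ⟨s, hs1, hsL, hspec, ?_⟩
    by_contra hc; push Not at hc
    exact hnst (hsticky_of (s - 1) (by omega) hc.1 hc.2)
  -- packaging
  have conclude : ∀ (A : ℝ) (b e : ℕ), Ν ≤ A → 6 / 5 * A * (1 + 4 * ε) + 2 ≤ 4 * Ν →
      (6 / 5 * A * (1 + 4 * ε) + 2 ≤ D ∨ D ≤ A * (1 - 4 * ε) - 2) → b < e → e ≤ M →
      (∀ l, b ≤ l → l ≤ e → St l) → (∀ l, b < l → l < e → A < d l ∧ d l < 6 / 5 * A) →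
      ((d b ≤ A ∧ 6 / 5 * A ≤ d e) ∨ (6 / 5 * A ≤ d b ∧ d e ≤ A)) →
      ∃ l' ≤ M + 1, μ l' ≤ mw ∧ ν l' < RB / 4 ∧ mw - 2 ≤ ν l' ∧
        ∃ A : ℝ, ν l' ≤ A ∧ 6 / 5 * A * (1 + 4 * ε) + 2 ≤ 4 * ν l' ∧
          (6 / 5 * A * (1 + 4 * ε) + 2 ≤ D ∨ D ≤ A * (1 - 4 * ε) - 2) ∧
          ∃ b e : ℕ, b < e ∧ e ≤ M ∧
            (∀ l, b ≤ l → l ≤ e → Θ ≤ d l ∧ d l ≤ 4 * ν l' ∧ ρm l < ε * d l ∧ ρp l < ε * d l) ∧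
            (∀ l, b < l → l < e → A < d l ∧ d l < 6 / 5 * A) ∧
            ((d b ≤ A ∧ 6 / 5 * A ≤ d e) ∨ (6 / 5 * A ≤ d b ∧ d e ≤ A)) :=
    fun A b e hA1 hA2 hA3 hbe heM hst hband hends =>
      ⟨l', hl'M1, hl'μ, hgood, hΝmw, A, hA1, hA2, hA3, b, e, hbe, heM, fun l h1 h2 => hst l h1 h2, hband, hends⟩
  -- arithmetic for the two candidate families
  have h14 : 1 + 4 * ε ≤ 26 / 25 := by linarith
  have hsmallA : ∀ A, (A = Ν + 3 ∨ A = 7 / 5 * (Ν + 3)) → Ν ≤ A ∧ 6 / 5 * A ≤ 42 / 25 * (Ν + 3) ∧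
      6 / 5 * A * (1 + 4 * ε) + 2 ≤ 44 / 25 * (Ν + 3) + 2 := by
    intro A hA
    have hA0 : 0 ≤ A := by rcases hA with rfl | rfl <;> linarith
    have hA1 : 6 / 5 * A ≤ 42 / 25 * (Ν + 3) := by rcases hA with rfl | rfl <;> linarith
    refine ⟨by rcases hA with rfl | rfl <;> linarith, hA1, ?_⟩
    have : 6 / 5 * A * (1 + 4 * ε) ≤ 42 / 25 * (Ν + 3) * (26 / 25) :=
      mul_le_mul hA1 h14 (by linarith) (by positivity)
    linarith
  have hbigA : ∀ A, (A = 2 * Ν ∨ A = 7 / 5 * (2 * Ν)) → 2 * Ν ≤ A ∧ 6 / 5 * A ≤ 84 / 25 * Ν ∧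
      6 / 5 * A * (1 + 4 * ε) + 2 ≤ 88 / 25 * Ν + 2 := by
    intro A hA
    have hA1 : 6 / 5 * A ≤ 84 / 25 * Ν := by rcases hA with rfl | rfl <;> linarith
    refine ⟨by rcases hA with rfl | rfl <;> linarith, hA1, ?_⟩
    have : 6 / 5 * A * (1 + 4 * ε) ≤ 84 / 25 * Ν * (26 / 25) :=
      mul_le_mul hA1 h14 (by linarith) (by positivity)
    linarith
  -- run starts: just above Θ or just below 4Ν
  have hstart_lo : ∀ s, 1 ≤ s → s ≤ M → St s → d (s - 1) < Θ → d s ≤ Ν := by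
    intro s hs1 hsM hst hlt
    have h1 := (hstep s hs1 hsM hst).1
    have h2 : d s * (99 / 100) ≤ d s * (1 - ε) := by nlinarith [hst.1]
    nlinarith
  have hstart_hi : ∀ s, 1 ≤ s → s ≤ M → St s → 4 * Ν < d (s - 1) → 99 / 25 * Ν - 1 ≤ d s := by
    intro s hs1 hsM hst hlt
    have h1 := (hstep s hs1 hsM hst).2
    have h2 : d s * (1 + ε) ≤ d s * (101 / 100) := by nlinarith [hst.1]
    nlinarith
  -- from `τ - 1 < d L (1+ε)` to a linear bound
  have hlin : ∀ (τ x : ℝ), 0 ≤ x → τ - 1 < x * (1 + ε) → 100 / 101 * (τ - 1) ≤ x := by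
    intro τ x hx h1
    have : x * (1 + ε) ≤ x * (101 / 100) := by nlinarith
    nlinarith
  -- Stage 1: τ₁ = 4Ν
  obtain ⟨L₁, hL₁M, -, hdL₁, hStL₁⟩ := hF3 (4 * Ν) (by linarith) le_rfl
  have hdL₁' : 100 / 101 * (4 * Ν - 1) ≤ d L₁ := hlin _ _ (by linarith [hStL₁.1]) hdL₁
  obtain ⟨s₁, hs₁1, hs₁L, hrun₁, hpred₁⟩ := hrun L₁ hL₁M.le hStL₁
  rcases hpred₁ with hlo | hhi
  · -- case (i): band with base among {Ν+3, 7(Ν+3)/5} inside [Ν, d L₁]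
    obtain ⟨A, hA, hAD⟩ := band_avoid_HT5 hε hε' D (Ν + 3) (by linarith)
    obtain ⟨hA1, hA65, hA2⟩ := hsmallA A hA
    have hds₁ : d s₁ ≤ A := (hstart_lo s₁ hs₁1 (by omega) (hrun₁ s₁ le_rfl hs₁L) hlo).trans hA1
    obtain ⟨b, e, hsb, hbe, heL, hdb, hde, hband⟩ :=
      ivt_up_HT5 d hs₁L (A := A) (B := 6 / 5 * A) (by linarith) hds₁ (by linarith)
    exact conclude A b e hA1 (by linarith) hAD hbe (by omega) (fun l h1 h2 => hrun₁ l (by omega) (by omega)) hband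
      (Or.inl ⟨hdb, hde⟩)
  · -- case (ii): Stage 2 with τ₂ = 2Ν
    obtain ⟨L₂, hL₂M, hdL₂le, hdL₂, hStL₂⟩ := hF3 (2 * Ν) (by linarith) (by linarith)
    have hdL₂' : 100 / 101 * (2 * Ν - 1) ≤ d L₂ := hlin _ _ (by linarith [hStL₂.1]) hdL₂
    obtain ⟨s₂, hs₂1, hs₂L, hrun₂, hpred₂⟩ := hrun L₂ hL₂M.le hStL₂
    rcases hpred₂ with hlo | hhi₂
    · -- case (i'): band with small base inside [Ν, d L₂]
      obtain ⟨A, hA, hAD⟩ := band_avoid_HT5 hε hε' D (Ν + 3) (by linarith)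
      obtain ⟨hA1, hA65, hA2⟩ := hsmallA A hA
      have hds₂ : d s₂ ≤ A := (hstart_lo s₂ hs₂1 (by omega) (hrun₂ s₂ le_rfl hs₂L) hlo).trans hA1
      obtain ⟨b, e, hsb, hbe, heL, hdb, hde, hband⟩ :=
        ivt_up_HT5 d hs₂L (A := A) (B := 6 / 5 * A) (by linarith) hds₂ (by linarith)
      exact conclude A b e hA1 (by linarith) hAD hbe (by omega) (fun l h1 h2 => hrun₂ l (by omega) (by omega)) hband
        (Or.inl ⟨hdb, hde⟩)
    · -- case (ii'): decreasing crawl with big base inside [2Ν, d s₂]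
      obtain ⟨A, hA, hAD⟩ := band_avoid_HT5 hε hε' D (2 * Ν) (by linarith)
      obtain ⟨hA1, hA65, hA2⟩ := hbigA A hA
      have hds₂ : 6 / 5 * A ≤ d s₂ := by
        have := hstart_hi s₂ hs₂1 (by omega) (hrun₂ s₂ le_rfl hs₂L) hhi₂; linarith
      obtain ⟨b, e, hsb, hbe, heL, hdb, hde, hband⟩ :=
        ivt_down_HT5 d hs₂L (A := A) (B := 6 / 5 * A) (by linarith) hds₂ (by linarith)
      exact conclude A b e (by linarith) (by linarith) hAD hbe (by omega) (fun l h1 h2 => hrun₂ l (by omega) (by omega))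
        hband (Or.inr ⟨hdb, hde⟩)

/-- **The touchdown trichotomy** (registered anchor `ufrs_crawlTrichotomy` of
stmt-CriticalPhenomena-11387; `crawl_trichotomy_HT5` verbatim with all binders explicit). -/
theorem ufrs_crawlTrichotomy : ∀ (M : ℕ) (μ ν d ρm ρp : ℕ → ℝ) (r₀ Rfar mw Θ RB ε D : ℝ), 0 < ε → ε ≤ 1 / 100 → 0 ≤ r₀ → 2 * r₀ + 2 ≤ Θ → 2 * Θ + 8 ≤ mw → 102 ≤ mw → mw ≤ RB → (1 + ε) * RB ≤ Rfar → (∀ l ≤ M, μ l ≤ d l + 1 ∧ d l - 1 ≤ ν l) → (∀ l ≤ M, μ (l + 1) ≤ d l + 1 ∧ d l - 1 ≤ ν (l + 1)) → (∀ l ≤ M, d l - μ l ≤ ρm l ∧ ν l - d l ≤ ρm l ∧ d l - μ (l + 1) ≤ ρp l ∧ ν (l + 1) - d l ≤ ρp l) → μ 0 ≤ r₀ → Rfar ≤ ν (M + 1) → (∃ l ≤ M + 1, μ l ≤ mw ∧ RB / 4 ≤ ν l) ∨ (∃ l ≤ M, ∃ l' ≤ M + 1, μ l' ≤ mw ∧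 ν l' < RB / 4 ∧ Θ ≤ d l ∧ d l ≤ 4 * ν l' ∧ (ε * d l ≤ ρm l ∨ ε * d l ≤ ρp l)) ∨ (∃ l' ≤ M + 1, μ l' ≤ mw ∧ ν l' < RB / 4 ∧ mw - 2 ≤ ν l' ∧ ∃ A : ℝ, ν l' ≤ A ∧ 6 / 5 * A * (1 + 4 * ε) + 2 ≤ 4 * ν l' ∧ (6 / 5 * A * (1 + 4 * ε) + 2 ≤ D ∨ D ≤ A * (1 - 4 * ε) - 2) ∧ ∃ b e : ℕ, b < e ∧ e ≤ M ∧ (∀ l, b ≤ l → l ≤ e → Θ ≤ d l ∧ d l ≤ 4 * ν l' ∧ ρm l < ε * d l ∧ ρp l < ε * d l) ∧ (∀ l, b < l → l < e → A < d l ∧ d l < 6 / 5 * A) ∧ ((d b ≤ A ∧ 6 / 5 * A ≤ d e) ∨ (6 / 5 * A ≤ d b ∧ d e ≤ A))) :=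
  fun M μ ν d ρm ρp r₀ Rfar mw Θ RB ε D hε hε' hr₀ hΘ hmw hmw' hRB hfar H1 H2 H3 H4 H5 =>
    crawl_trichotomy_HT5 M μ ν d ρm ρp r₀ Rfar mw Θ RB ε D hε hε' hr₀ hΘ hmw hmw' hRB hfar H1 H2 H3 H4 H5

end

end Summit.CriticalPhenomena.CardyFormulaZ2.Cruxes.EdgePrecompact.QkzStripBoundaryArm
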